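import Literature.AlgebraicGeometry.Resolution.KawasakiBlowupCM
import Literature.AlgebraicGeometry.Resolution.BlowupStalkCharts
import Literature.AlgebraicGeometry.Resolution.MacaulayficationCentre
import Mathlib.AlgebraicGeometry.FunctionField
import HarnessLib

/-!
# Kawasaki's theorem on the stalks of a blowing up along the Kawasaki centre

Topic: `Literature/AlgebraicGeometry/Resolution`. The scheme-level form of Kawasaki 2000, Thm. 4.1
(1) for `M = R` (Česnavičius 2021, Thm. 3.13), as consumed by the globalization
(`kawasakiMacaulayfication_of_exists_isBlowup_nonCMLocus`): let `π : X' → X` be a blowing up of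
the integral locally Noetherian scheme `X` along an ideal sheaf `J`, `x' ∈ X'`, and suppose that the
stalk `J_{π x'} ⊆ R = 𝒪_{X, π x'}` is the Kawasaki centre `∏_{t<d} (x_{t+1},…,x_d)` of a
`p`-standard system of parameters `x_1,…,x_d` of `R` with `dim R ≤ d`. Then the local ring
`𝒪_{X',x'}` is Cohen–Macaulay (`IsBlowup.cmClause_stalk_of_kCentre`): it is a localization of a
chart `R[J/G]` at a prime over `𝔪` (`IsBlowup.exists_reesChart_stalk`) for `G` one of the product
monomials generating the centre (`kCentreGens`), and those local rings are Cohen–Macaulay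
(`cmClause_of_adm`, `KawasakiBlowupCM.lean`).

Also: the centre of `MacaulayficationCentre.lean` is the level-`0` centre of
`KawasakiBlowupInduction.lean` (`kawasakiCenter_eq_kCentre`).

Everything is proved; no named facts.

## References

* [Kawasaki2000] T. Kawasaki, *On Macaulayfication of Noetherian schemes*, Trans. AMS 352 (2000),
  Thm. 4.1, Cor. 4.2.
* [Cesnavicius2021] K. Česnavičius, *Macaulayfication of Noetherian schemes*, Duke Math. J. 170
  (2021), Thm. 3.13.
* [StacksProject] The Stacks Project, Tag 0804.
-/

noncomputable section

open IsLocalRing Ideal IsLocalization RingTheory.Sequence CategoryTheory AlgebraicGeometry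

namespace Literature.AlgebraicGeometry.Resolution

universe u

/-! ## The two centres agree -/

section Centre

variable {R : Type u} [CommRing R]

/-- `List.prod` over `List.range` is the `Finset.prod` over `Finset.range`. [folklore] -/
theorem list_prod_map_range_eq {M : Type*} [CommMonoid M] (f : ℕ → M) (n : ℕ) :
    ((List.range n).map f).prod = ∏ i ∈ Finset.range n, f i := by
  induction n with
  | zero => simp
  | succ n ih => rw [List.range_succ, List.map_append, List.prod_append, ih, List.map_singleton,
      List.prod_singleton, Finset.prod_range_succ]

/-- **`kawasakiCenter xs = kCentre xs 0`** (nonempty `xs`): the centre `∏_{i<d} (x_{i+1},…,x_d)`.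
[cite: Kawasaki2000, Thm. 4.1] -/
theorem kawasakiCenter_eq_kCentre {xs : List R} (h : 0 < xs.length) :
    kawasakiCenter xs = kCentre xs 0 := by
  rw [kawasakiCenter, list_prod_map_range_eq, kCentre_eq_prod_Ico h, Finset.range_eq_Ico]

end Centre

/-! ## A finite family of generators: the product monomials -/

section Gens

variable {R : Type u} [CommRing R] (xs : List R)

/-- The admissible choice function attached to `m : Fin d → Fin d`: `t ↦ max t (m t)`.
[folklore] -/
def admFun (d : ℕ) (m : Fin d → Fin d) : ℕ → ℕ := fun t => if h : t < d then max t (m ⟨t, h⟩) else t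

omit [CommRing R] in
/-- `admFun` is admissible. [folklore] -/
theorem adm_admFun (m : Fin xs.length → Fin xs.length) : Adm xs (admFun xs.length m) := by
  intro t ht
  simp only [admFun, dif_pos ht]
  exact ⟨le_max_left _ _, max_lt ht (m ⟨t, ht⟩).2⟩

/-- **The product monomials `G_f`, as a finite family.** [cite: Kawasaki2000, Thm. 4.1 (proof)] -/
def kCentreGens : Fin (Fintype.card (Fin xs.length → Fin xs.length)) → R := fun j =>
  rawProd xs (admFun xs.length ((Fintype.equivFin (Fin xs.length → Fin xs.length)).symm j)) 0

/-- `rawProd` only depends on the values below `d`. [folklore] -/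
theorem rawProd_congr {f f' : ℕ → ℕ} (h : ∀ t, t < xs.length → f t = f' t) :
    rawProd xs f 0 = rawProd xs f' 0 :=
  Finset.prod_congr rfl fun t ht => by rw [h t (Finset.mem_Ico.mp ht).2]

/-- **The product monomials generate the centre.** [cite: Kawasaki2000, Thm. 4.1 (proof)] -/
theorem span_range_kCentreGens (h : 0 < xs.length) :
    Ideal.span (Set.range (kCentreGens xs)) = kCentre xs 0 := by
  rw [← span_rawProd_eq_kCentre h]
  congr 1
  ext G
  constructor
  · rintro ⟨j, rfl⟩
    exact ⟨_, adm_admFun xs _, rfl⟩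
  · rintro ⟨f, hf, rfl⟩
    refine ⟨Fintype.equivFin _ (fun t => ⟨f t, (hf t t.2).2⟩), ?_⟩
    simp only [kCentreGens, Equiv.symm_apply_apply]
    refine rawProd_congr xs fun t ht => ?_
    simp only [admFun, dif_pos ht]
    exact max_eq_right (hf t ht).1

end Gens

/-! ## The local rings of the blowing up -/

section Stalks

variable {R : Type u} [CommRing R] [IsDomain R] [IsNoetherianRing R] [IsLocalRing R] {xs : List R}

/-- `cmClause_of_adm_of_isWeaklyRegular` with the centre given up to propositional equality.
[folklore] -/
theorem cmClause_of_adm_of_eq (hx : IsPStandard R xs) {Z : List R}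
    (hsec : IsSecantSequence R (xs ++ Z)) (hZm : ∀ z ∈ Z, z ∈ maximalIdeal R)
    (hreg : IsWeaklyRegular (R ⧸ Ideal.ofList xs) Z)
    (hd : ringKrullDim R ≤ xs.length + Z.length)
    (hd0 : 0 < xs.length) {f : ℕ → ℕ} (hf : Adm xs f) {I : Ideal R} (hI : I = kCentre xs 0)
    (𝔴 : Ideal (blowupAlgebra I (rawProd xs f 0))) [𝔴.IsPrime]
    (h𝔴 : 𝔴.comap (algebraMap R (blowupAlgebra I (rawProd xs f 0))) = maximalIdeal R)
    (S : Type u) [CommRing S] [Algebra (blowupAlgebra I (rawProd xs f 0)) S]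
    [IsLocalization.AtPrime S 𝔴] :
    ∀ n : ℕ, ringKrullDim S = n → ∀ s : Fin n → S,
      (Ideal.span (Set.range s)).radical.IsMaximal → IsWeaklyRegular S (List.ofFn s) := by
  subst hI
  exact cmClause_of_adm_of_isWeaklyRegular hx hsec hZm hreg hd hd0 hf 𝔴 h𝔴 S

/-- **The Rees charts at the product monomials are Cohen–Macaulay over `𝔪`**: for the chart ring
`B_j = (R[It])_{(G_j t)}` of `Bl_I(Spec R) = Proj R[It]`, `I` the Kawasaki centre of `xs`
generated by the product monomials `G_j` (`kCentreGens`), `xs` `p`-standard and part of a system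
of parameters `xs, Z` with `Z` regular on `R/(xs)` and `dim R ≤ |xs| + |Z|`, every localization at
a prime over `𝔪` satisfies the Cohen–Macaulay clause. [cite: Kawasaki2000, Thm. 4.1, Cor. 4.2]
[cite: Cesnavicius2021, Thm. 3.13] -/
theorem cmClause_of_isLocalization_chartRing_kCentreGens (hx : IsPStandard R xs) {Z : List R}
    (hsec : IsSecantSequence R (xs ++ Z)) (hZm : ∀ z ∈ Z, z ∈ maximalIdeal R)
    (hreg : IsWeaklyRegular (R ⧸ Ideal.ofList xs) Z)
    (hd : ringKrullDim R ≤ xs.length + Z.length) (hd0 : 0 < xs.length)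
    (j : Fin (Fintype.card (Fin xs.length → Fin xs.length)))
    (𝔴 : Ideal (chartRing (kCentreGens xs) j)) [𝔴.IsPrime]
    (h𝔴 : 𝔴.comap (chartBase (kCentreGens xs) j) = maximalIdeal R)
    (S : Type u) [CommRing S] [Algebra (chartRing (kCentreGens xs) j) S]
    [IsLocalization.AtPrime S 𝔴] :
    ∀ n : ℕ, ringKrullDim S = n → ∀ s : Fin n → S,
      (Ideal.span (Set.range s)).radical.IsMaximal → IsWeaklyRegular S (List.ofFn s) := by
  -- `ε : B_j ≃ R[I/G_j]`
  obtain ⟨ε, hε⟩ : ∃ ε : chartRing (kCentreGens xs) j ≃+*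
      blowupAlgebra (Ideal.span (Set.range (kCentreGens xs))) (kCentreGens xs j),
      ε = reesChartEquiv (kCentreGens xs j)
        (Ideal.mem_span_range_self (f := kCentreGens xs) (x := j)) := ⟨_, rfl⟩
  have hεcomp : ε.toRingHom.comp (chartBase (kCentreGens xs) j) = algebraMap R _ := by
    rw [hε]; exact reesChartEquiv_comp_reesChartBase _ _
  letI algB : Algebra (blowupAlgebra (Ideal.span (Set.range (kCentreGens xs))) (kCentreGens xs j)) S :=
    ((algebraMap (chartRing (kCentreGens xs) j) S).comp ε.symm.toRingHom).toAlgebra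
  set 𝔴' : Ideal (blowupAlgebra (Ideal.span (Set.range (kCentreGens xs))) (kCentreGens xs j)) :=
    𝔴.comap ε.symm.toRingHom with h𝔴'
  haveI : 𝔴'.IsPrime := Ideal.comap_isPrime _ 𝔴
  haveI hloc : @IsLocalization.AtPrime _ _ S _ algB 𝔴' _ := by
    have h1 := IsLocalization.isLocalization_of_base_ringEquiv 𝔴.primeCompl S ε
    have h2 : 𝔴.primeCompl.map ε = 𝔴'.primeCompl := primeCompl_map_ringEquiv_comap_symm ε 𝔴
    change IsLocalization 𝔴'.primeCompl S
    rw [← h2]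
    exact h1
  have h𝔴'm : 𝔴'.comap (algebraMap R _) = maximalIdeal R := by
    rw [h𝔴', Ideal.comap_comap, ← h𝔴, ← hεcomp, ← RingHom.comp_assoc]
    congr 1
    refine RingHom.ext fun b => ?_
    show ε.symm (ε (chartBase _ j b)) = chartBase _ j b
    exact ε.symm_apply_apply _
  exact @cmClause_of_adm_of_eq R _ _ _ _ xs hx Z hsec hZm hreg hd hd0 _ (adm_admFun xs _) _
    (span_range_kCentreGens xs hd0) 𝔴' ‹_› h𝔴'm S _ algB hloc

end Stalks

/-! ## The scheme statements -/

section Scheme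

variable {X X' : Scheme.{u}} {π : X' ⟶ X} {J : X.IdealSheafData}

/-- **Kawasaki 2000, Thm. 4.1 / Cor. 4.2, Česnavičius 2021, Thm. 3.13, on the stalks of a
blowing up**: let `π : X' → X` be a blowing up of the integral locally Noetherian scheme `X`
along `J` and `x' ∈ X'`; if the stalk `J_{π x'}` is the Kawasaki centre `∏_{t<e}(x_{t+1},…,x_e)`
of a `p`-standard sequence `xs = x_1,…,x_e` (`e ≥ 1`) of `R = 𝒪_{X,π x'}`, part of a system of
parameters `xs, Z` with `Z ⊆ 𝔪` regular on `R/(xs)` and `dim R ≤ e + |Z|` (for `Z = []`: `xs` is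
a `p`-standard system of parameters), then `𝒪_{X',x'}` is Cohen–Macaulay: every system of
parameters of `𝒪_{X',x'}` is a (weakly) regular sequence.
[cite: Kawasaki2000, Thm. 4.1, Cor. 4.2] [cite: Cesnavicius2021, Thm. 3.13] -/
theorem IsBlowup.cmClause_stalk_of_kCentre_of_isWeaklyRegular [IsIntegral X] [IsLocallyNoetherian X]
    (hπ : IsBlowup π J) (x' : X') {xs Z : List (X.presheaf.stalk (π x'))}
    (hx : IsPStandard (X.presheaf.stalk (π x')) xs)
    (hsec : IsSecantSequence (X.presheaf.stalk (π x')) (xs ++ Z))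
    (hZm : ∀ z ∈ Z, z ∈ maximalIdeal (X.presheaf.stalk (π x')))
    (hreg : IsWeaklyRegular (X.presheaf.stalk (π x') ⧸ Ideal.ofList xs) Z)
    (hd : ringKrullDim (X.presheaf.stalk (π x')) ≤ xs.length + Z.length) (hd0 : 0 < xs.length)
    (hJ : stalkIdeal J (π x') = kCentre xs 0) :
    ∀ n : ℕ, ringKrullDim (X'.presheaf.stalk x') = n → ∀ s : Fin n → X'.presheaf.stalk x',
      (Ideal.span (Set.range s)).radical.IsMaximal →
        IsWeaklyRegular (X'.presheaf.stalk x') (List.ofFn s) := by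
  have hc : Ideal.span (Set.range (kCentreGens xs)) = stalkIdeal J (π x') := by
    rw [span_range_kCentreGens xs hd0, hJ]
  obtain ⟨j, 𝔴, χ, -, hloc, h𝔴⟩ := hπ.exists_reesChart_stalk x' (kCentreGens xs) hc
  letI := χ.toAlgebra
  haveI : IsLocalization.AtPrime (X'.presheaf.stalk x') 𝔴.asIdeal := hloc
  exact cmClause_of_isLocalization_chartRing_kCentreGens hx hsec hZm hreg hd hd0 j 𝔴.asIdeal h𝔴
    (X'.presheaf.stalk x')

/-- **The case of a `p`-standard system of parameters** (`Z = []`, `dim R ≤ |xs|`): the stalks of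
the blowing up along the Kawasaki centre are Cohen–Macaulay.
[cite: Kawasaki2000, Thm. 4.1 (1)] [cite: Cesnavicius2021, Thm. 3.13] -/
theorem IsBlowup.cmClause_stalk_of_kCentre [IsIntegral X] [IsLocallyNoetherian X]
    (hπ : IsBlowup π J) (x' : X') {xs : List (X.presheaf.stalk (π x'))}
    (hx : IsPStandard (X.presheaf.stalk (π x')) xs)
    (hd : ringKrullDim (X.presheaf.stalk (π x')) ≤ xs.length) (hd0 : 0 < xs.length)
    (hJ : stalkIdeal J (π x') = kCentre xs 0) :
    ∀ n : ℕ, ringKrullDim (X'.presheaf.stalk x') = n → ∀ s : Fin n → X'.presheaf.stalk x',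
      (Ideal.span (Set.range s)).radical.IsMaximal →
        IsWeaklyRegular (X'.presheaf.stalk x') (List.ofFn s) :=
  hπ.cmClause_stalk_of_kCentre_of_isWeaklyRegular x' hx (Z := [])
    (by rw [List.append_nil]; exact hx.isSecantSequence) (fun _ h => by simp at h)
    (RingTheory.Sequence.IsWeaklyRegular.nil _ _)
    (by rw [List.length_nil, Nat.cast_zero, add_zero]; exact hd) hd0 hJ

/-- The same with the centre of `MacaulayficationCentre.lean`.
[cite: Kawasaki2000, Thm. 4.1, Cor. 4.2] [cite: Cesnavicius2021, Thm. 3.13] -/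
theorem IsBlowup.cmClause_stalk_of_kawasakiCenter [IsIntegral X] [IsLocallyNoetherian X]
    (hπ : IsBlowup π J) (x' : X') {xs Z : List (X.presheaf.stalk (π x'))}
    (hx : IsPStandard (X.presheaf.stalk (π x')) xs)
    (hsec : IsSecantSequence (X.presheaf.stalk (π x')) (xs ++ Z))
    (hZm : ∀ z ∈ Z, z ∈ maximalIdeal (X.presheaf.stalk (π x')))
    (hreg : IsWeaklyRegular (X.presheaf.stalk (π x') ⧸ Ideal.ofList xs) Z)
    (hd : ringKrullDim (X.presheaf.stalk (π x')) ≤ xs.length + Z.length) (hd0 : 0 < xs.length)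
    (hJ : stalkIdeal J (π x') = kawasakiCenter xs) :
    ∀ n : ℕ, ringKrullDim (X'.presheaf.stalk x') = n → ∀ s : Fin n → X'.presheaf.stalk x',
      (Ideal.span (Set.range s)).radical.IsMaximal →
        IsWeaklyRegular (X'.presheaf.stalk x') (List.ofFn s) :=
  hπ.cmClause_stalk_of_kCentre_of_isWeaklyRegular x' hx hsec hZm hreg hd hd0
    (hJ.trans (kawasakiCenter_eq_kCentre hd0))

end Scheme

end Literature.AlgebraicGeometry.Resolution

end
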